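import Mathlib.Analysis.Distribution.SchwartzSpace.Fourier
import Mathlib.Analysis.Fourier.FourierTransformDeriv
import Mathlib.Analysis.SpecialFunctions.SmoothTransition
import Mathlib.Analysis.SpecialFunctions.JapaneseBracket
import Mathlib.Analysis.InnerProductSpace.Calculus
import Mathlib.MeasureTheory.Measure.Haar.NormedSpace
import Literature.MathematicalPhysics.QuantumLattice.SchwartzPartition
import Literature.MathematicalPhysics.QuantumLattice.SchwartzFourierDensity
import HarnessLib

/-!
# A bounded function whose Fourier transform is supported at the origin is constant, I: tools

Topic `Literature/Analysis/Distribution`. The classical structure theorem for distributions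
supported at a point (Hörmander, *ALPDO I*, Thm. 2.3.4: a distribution supported at `{0}` is a
finite sum `Σ c_α ∂^α δ`) gives: a tempered distribution whose Fourier transform is supported at
the origin is a polynomial, hence constant if bounded. This is the mechanism behind "Since there
are no states with space-like momentum, (4-79) must be a multiple of `Ψ₀`" in the proof of the
Jost–Schroer theorem (Streater–Wightman §4-5, (4-79)–(4-80)): a vector of a unitary representation
of the translation group whose spectral support is `{0}` is invariant. This file **proves** the
bounded case directly, in the test-function form used by the tree's spectral condition
(`Literature.Analysis.UnboundedOperators.UnitaryRep.fourierMatrixCoeff`,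
`HasFourierSpectrumIn`): for a bounded continuous `t : V → ℂ` on a finite-dimensional real inner
product space,

  `(∀ h ∈ 𝒮(V), 0 ∉ supp h → ∫ 𝓕h(a) t(a) da = 0) → t` is constant

(`eq_of_forall_integral_fourier_mul_eq_zero`, in the sibling `FourierSupportAtZeroConst`), without
the structure theorem; this file provides the tools:

* the hypothesis is invariant under translation of `t` (`∫ 𝓕h(a) t(a + c) da = ∫ 𝓕(𝐞(⟨·, c⟩)h) t`,
  the character having temperate growth and not changing supports);
* with the smooth plateau functions `Θ_R(ξ) = σ(2 − ‖ξ‖²/R²)` (`= 1` on `‖ξ‖ ≤ R`, `= 0` on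
  `‖ξ‖ ≥ 2R`; `plateau`), the numbers `∫ 𝓕Θ_R · t` do not depend on `R` (`Θ_R − Θ_R'` vanishes
  near `0`), and tend to `t(0)` as `R → ∞` (`𝓕Θ_R(u) = Rⁿ 𝓕Θ₁(Ru)` is an approximate identity,
  `∫ 𝓕Θ₁ = Θ₁(0) = 1`), so `t(0) = ∫ 𝓕Θ_R · t` for every `R > 0`; hence
  `t(c) − t(c') = ∫ (𝓕Θ_R(v − c) − 𝓕Θ_R(v − c')) t(v) dv`, bounded by
  `‖t‖_∞ ∫ |𝓕Θ₁(w + R(c − c')) − 𝓕Θ₁(w)| dw → 0` as `R → 0⁺` (continuity of translation in `L¹`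
  for the Schwartz function `𝓕Θ₁`).

## References

* L. Hörmander, *The Analysis of Linear Partial Differential Operators I*, Thm. 2.3.4
  (distributions supported at a point). [HormanderALPDO1]
* R. F. Streater, A. S. Wightman, *PCT, Spin and Statistics, and All That*, §4-5, proof of
  Thm 4-15, (4-79)–(4-80). [StreaterWightman2001]

## Mathlib / tree

Used: `HasCompactSupport.toSchwartzMap`, `Real.smoothTransition`, `contDiff_norm_sq`,
`Real.fourier_eq`, `Real.fourierInv_eq`, `FourierTransform.fourierInv_fourier_eq` (inversion on
`𝒮`), `MeasureTheory.Measure.integral_comp_smul_of_nonneg` / `integral_comp_inv_smul_of_nonneg`,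
`integral_add_right_eq_self`, `integrable_one_add_norm`,
`tendsto_integral_filter_of_dominated_convergence`, `SchwartzMap.smulLeftCLM`; from the tree
`hasTemperateGrowth_of_bounds` (`SchwartzPartition`), `contDiff_fourierChar`,
`norm_iteratedFDeriv_fourierChar` (`SchwartzFourierDensity`).
-/

noncomputable section

open MeasureTheory Filter FourierTransform Real Complex
open scoped Topology SchwartzMap InnerProductSpace ContDiff

namespace Literature.Analysis.Distribution

open Literature.MathematicalPhysics.QuantumLattice

/-! ### Plateau functions -/

section Plateau

variable {V : Type*} [NormedAddCommGroup V]

/-- The smooth plateau `Θ_R(ξ) = σ(2 − ‖ξ‖²/R²)`, `σ` Mathlib's smooth transition: equal to `1`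
on the ball `‖ξ‖ ≤ R` and to `0` outside the ball `‖ξ‖ < 2R`. [folklore] -/
def plateau (R : ℝ) (ξ : V) : ℂ :=
  (Real.smoothTransition (2 - ‖ξ‖ ^ 2 / R ^ 2) : ℂ)

/-- `Θ_R = 1` on `‖ξ‖ ≤ R`. [folklore] -/
theorem plateau_eq_one {R : ℝ} (hR : 0 < R) {ξ : V} (h : ‖ξ‖ ≤ R) : plateau R ξ = 1 := by
  unfold plateau
  have h1 : ‖ξ‖ ^ 2 / R ^ 2 ≤ 1 := by
    rw [div_le_one (by positivity)]
    exact pow_le_pow_left₀ (norm_nonneg _) h 2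
  rw [Real.smoothTransition.one_of_one_le (by linarith), Complex.ofReal_one]

/-- `Θ_R = 0` on `‖ξ‖ ≥ 2R`. [folklore] -/
theorem plateau_eq_zero {R : ℝ} (hR : 0 < R) {ξ : V} (h : 2 * R ≤ ‖ξ‖) : plateau R ξ = 0 := by
  unfold plateau
  have h1 : (2 * R) ^ 2 ≤ ‖ξ‖ ^ 2 := pow_le_pow_left₀ (by positivity) h 2
  have h2 : 2 ≤ ‖ξ‖ ^ 2 / R ^ 2 := by
    rw [le_div_iff₀ (by positivity)]
    nlinarith
  rw [Real.smoothTransition.zero_of_nonpos (by linarith), Complex.ofReal_zero]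

variable [NormedSpace ℝ V]

/-- `Θ_R` has compact support (in the closed ball of radius `2R`). [folklore] -/
theorem hasCompactSupport_plateau [FiniteDimensional ℝ V] {R : ℝ} (hR : 0 < R) :
    HasCompactSupport (plateau (V := V) R) := by
  refine HasCompactSupport.intro (isCompact_closedBall (0 : V) (2 * R)) fun ξ hξ => ?_
  rw [Metric.mem_closedBall, dist_zero_right, not_le] at hξ
  exact plateau_eq_zero hR hξ.le

/-- Scaling: `Θ_R(ξ) = Θ₁(ξ/R)`. [folklore] -/
theorem plateau_eq_plateau_one_inv_smul {R : ℝ} (hR : 0 < R) (ξ : V) :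
    plateau R ξ = plateau 1 (R⁻¹ • ξ) := by
  unfold plateau
  rw [norm_smul, norm_inv, Real.norm_eq_abs, abs_of_pos hR, one_pow, div_one, mul_pow, inv_pow,
    div_eq_inv_mul]

end Plateau

variable {V : Type*} [NormedAddCommGroup V] [InnerProductSpace ℝ V] [FiniteDimensional ℝ V]
  [MeasurableSpace V] [BorelSpace V]

omit [FiniteDimensional ℝ V] [MeasurableSpace V] [BorelSpace V] in
/-- `Θ_R` is smooth. [folklore] -/
theorem contDiff_plateau (R : ℝ) : ContDiff ℝ ∞ (plateau (V := V) R) := by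
  unfold plateau
  exact Complex.ofRealCLM.contDiff.comp (Real.smoothTransition.contDiff.comp
    (contDiff_const.sub ((contDiff_norm_sq ℝ).div_const _)))

/-- The plateau as a Schwartz function. [folklore] -/
def plateauSchwartz {R : ℝ} (hR : 0 < R) : 𝓢(V, ℂ) :=
  (hasCompactSupport_plateau hR).toSchwartzMap (contDiff_plateau R)

omit [MeasurableSpace V] [BorelSpace V] in
/-- Values of `plateauSchwartz`. [folklore] -/
@[simp]
theorem plateauSchwartz_apply {R : ℝ} (hR : 0 < R) (ξ : V) :
    plateauSchwartz (V := V) hR ξ = plateau R ξ :=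
  rfl

omit [MeasurableSpace V] [BorelSpace V] in
/-- Two plateaus agree (with value `1`) near the origin, so `0` is not in the support of their
difference. [folklore] -/
theorem zero_notMem_tsupport_plateauSchwartz_sub {R R' : ℝ} (hR : 0 < R) (hR' : 0 < R') :
    (0 : V) ∉ tsupport ((plateauSchwartz (V := V) hR - plateauSchwartz hR' : 𝓢(V, ℂ)) : V → ℂ) := by
  rw [notMem_tsupport_iff_eventuallyEq]
  filter_upwards [Metric.closedBall_mem_nhds (0 : V) (lt_min hR hR')] with ξ hξ
  rw [Metric.mem_closedBall, dist_zero_right, le_min_iff] at hξ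
  change plateau R ξ - plateau R' ξ = 0
  rw [plateau_eq_one hR hξ.1, plateau_eq_one hR' hξ.2, sub_self]

/-- **Fourier scaling of the plateaus**: `𝓕Θ_R(u) = Rⁿ 𝓕Θ₁(R u)`, `n = dim V`. [folklore] -/
theorem fourier_plateauSchwartz_apply {R : ℝ} (hR : 0 < R) (u : V) :
    (𝓕 (plateauSchwartz (V := V) hR) : 𝓢(V, ℂ)) u =
      (R ^ Module.finrank ℝ V : ℝ) • (𝓕 (plateauSchwartz (V := V) one_pos) : 𝓢(V, ℂ)) (R • u) := by
  change 𝓕 (plateau (V := V) R) u = (R ^ Module.finrank ℝ V : ℝ) • 𝓕 (plateau (V := V) 1) (R • u)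
  rw [Real.fourier_eq, Real.fourier_eq]
  have : (fun v : V => 𝐞 (-⟪v, u⟫_ℝ) • plateau R v) =
      fun v => (fun w : V => 𝐞 (-⟪w, R • u⟫_ℝ) • plateau (1 : ℝ) w) (R⁻¹ • v) := by
    funext v
    simp only [plateau_eq_plateau_one_inv_smul hR v, real_inner_smul_left, real_inner_smul_right]
    congr 3
    field_simp
  rw [this, Measure.integral_comp_inv_smul_of_nonneg volume
    (fun w : V => 𝐞 (-⟪w, R • u⟫_ℝ) • plateau (1 : ℝ) w) hR.le]

/-- `∫ 𝓕Θ₁ = Θ₁(0) = 1` (Fourier inversion at the origin). [folklore] -/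
theorem integral_fourier_plateauSchwartz_one :
    ∫ v, (𝓕 (plateauSchwartz (V := V) one_pos) : 𝓢(V, ℂ)) v = 1 := by
  have h : (𝓕⁻ (𝓕 (plateauSchwartz (V := V) one_pos) : 𝓢(V, ℂ)) : 𝓢(V, ℂ)) =
      plateauSchwartz (V := V) one_pos :=
    FourierTransform.fourierInv_fourier_eq _
  have h0 := congrArg (fun f : 𝓢(V, ℂ) => f 0) h
  simp only [plateauSchwartz_apply] at h0
  rw [plateau_eq_one one_pos (by simp), congrFun (SchwartzMap.fourierInv_coe _) 0,
    Real.fourierInv_eq] at h0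
  simpa using h0

/-! ### The Fourier pairing with a bounded continuous function -/

section Pairing

variable {t : V → ℂ} {C : ℝ}

/-- `𝓕h · t` is integrable for `h` Schwartz and `t` bounded continuous. [folklore] -/
theorem integrable_fourier_mul (ht : Continuous t) (hC : ∀ a, ‖t a‖ ≤ C) (h : 𝓢(V, ℂ)) :
    Integrable fun a => (𝓕 h : 𝓢(V, ℂ)) a * t a := by
  refine ((𝓕 h : 𝓢(V, ℂ)).integrable.norm.mul_const C).mono'
    (((𝓕 h : 𝓢(V, ℂ)).continuous.mul ht).aestronglyMeasurable) (Eventually.of_forall fun a => ?_)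
  rw [norm_mul]
  exact mul_le_mul_of_nonneg_left (hC a) (norm_nonneg _)

/-- The pairing is additive in the test function. [folklore] -/
theorem integral_fourier_sub_mul (ht : Continuous t) (hC : ∀ a, ‖t a‖ ≤ C) (h h' : 𝓢(V, ℂ)) :
    ∫ a, (𝓕 (h - h') : 𝓢(V, ℂ)) a * t a =
      (∫ a, (𝓕 h : 𝓢(V, ℂ)) a * t a) - ∫ a, (𝓕 h' : 𝓢(V, ℂ)) a * t a := by
  rw [← integral_sub (integrable_fourier_mul ht hC h) (integrable_fourier_mul ht hC h')]
  refine integral_congr_ae (Eventually.of_forall fun a => ?_)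
  have : (𝓕 (h - h') : 𝓢(V, ℂ)) = 𝓕 h - 𝓕 h' := map_sub (fourierCLM ℂ (𝓢(V, ℂ))) h h'
  simp only [this, sub_apply, sub_mul]

end Pairing

/-! ### Translation invariance of the hypothesis -/

omit [FiniteDimensional ℝ V] [MeasurableSpace V] [BorelSpace V] in
/-- The character `χ_c(v) = e^{2πi⟨v, c⟩}` of `V` as a complex-valued function. [folklore] -/
def fourierCharInner (c : V) : V → ℂ := fun v => ((𝐞 ⟪v, c⟫_ℝ : Circle) : ℂ)

omit [FiniteDimensional ℝ V] [MeasurableSpace V] [BorelSpace V] in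
/-- Values of `fourierCharInner`. [folklore] -/
theorem fourierCharInner_apply (c v : V) : fourierCharInner c v = ((𝐞 ⟪v, c⟫_ℝ : Circle) : ℂ) :=
  rfl

omit [FiniteDimensional ℝ V] [MeasurableSpace V] [BorelSpace V] in
/-- The character `v ↦ e^{2πi⟨v, c⟩}` has temperate growth. [folklore] -/
theorem hasTemperateGrowth_fourierCharInner (c : V) : (fourierCharInner c).HasTemperateGrowth := by
  have h1 : (fun s : ℝ => (𝐞 s : ℂ)).HasTemperateGrowth :=
    hasTemperateGrowth_of_bounds contDiff_fourierChar (fun k => (2 * π) ^ k)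
      fun k s => (norm_iteratedFDeriv_fourierChar k s).le
  exact h1.comp (Function.hasTemperateGrowth_inner_left c)

/-- **Multiplying by a character translates the Fourier transform**:
`𝓕(e^{2πi⟨·, c⟩} h)(w) = 𝓕h(w − c)`. [folklore] -/
theorem fourier_smulLeftCLM_fourierCharInner_apply (c : V) (h : 𝓢(V, ℂ)) (w : V) :
    (𝓕 (SchwartzMap.smulLeftCLM ℂ (fourierCharInner c) h) : 𝓢(V, ℂ)) w =
      (𝓕 h : 𝓢(V, ℂ)) (w - c) := by
  rw [congrFun (SchwartzMap.fourier_coe (SchwartzMap.smulLeftCLM ℂ (fourierCharInner c) h)) w,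
    congrFun (SchwartzMap.fourier_coe h) (w - c), Real.fourier_eq, Real.fourier_eq]
  refine integral_congr_ae (Eventually.of_forall fun v => ?_)
  simp only [SchwartzMap.smulLeftCLM_apply_apply (hasTemperateGrowth_fourierCharInner c),
    fourierCharInner_apply, Circle.smul_def, smul_eq_mul, inner_sub_right, neg_sub]
  rw [sub_eq_neg_add, AddChar.map_add_eq_mul, Circle.coe_mul, mul_assoc]

omit [FiniteDimensional ℝ V] [MeasurableSpace V] [BorelSpace V] in
/-- Multiplying by a character does not change the support. [folklore] -/
theorem tsupport_smulLeftCLM_fourierCharInner (c : V) (h : 𝓢(V, ℂ)) :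
    tsupport ((SchwartzMap.smulLeftCLM ℂ (fourierCharInner c) h : 𝓢(V, ℂ)) : V → ℂ) =
      tsupport (h : V → ℂ) := by
  unfold tsupport
  congr 1
  ext v
  rw [Function.mem_support, Function.mem_support,
    SchwartzMap.smulLeftCLM_apply_apply (hasTemperateGrowth_fourierCharInner c), smul_eq_mul,
    fourierCharInner_apply]
  simp [Circle.coe_ne_zero]

/-- **The hypothesis "the Fourier transform of `t` is supported at `0`" is translation
invariant.** [folklore] -/
theorem integral_fourier_mul_translate_eq_zero {t : V → ℂ}
    (h0 : ∀ h : 𝓢(V, ℂ), (0 : V) ∉ tsupport (h : V → ℂ) →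
      ∫ a, (𝓕 h : 𝓢(V, ℂ)) a * t a = 0)
    (c : V) (h : 𝓢(V, ℂ)) (hh : (0 : V) ∉ tsupport (h : V → ℂ)) :
    ∫ a, (𝓕 h : 𝓢(V, ℂ)) a * t (a + c) = 0 := by
  have h1 : (fun a => (𝓕 h : 𝓢(V, ℂ)) a * t (a + c)) =
      fun a => (fun v => (𝓕 h : 𝓢(V, ℂ)) (v - c) * t v) (a + c) := by
    funext a; simp
  rw [h1, integral_add_right_eq_self (fun v => (𝓕 h : 𝓢(V, ℂ)) (v - c) * t v) c]
  simp_rw [← fourier_smulLeftCLM_fourierCharInner_apply c h]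
  exact h0 _ (by rwa [tsupport_smulLeftCLM_fourierCharInner])

/-! ### Continuity of translation in `L¹` for Schwartz functions -/

omit [InnerProductSpace ℝ V] [FiniteDimensional ℝ V] [MeasurableSpace V] [BorelSpace V] in
/-- A Schwartz function is bounded by a multiple of the inverse Japanese bracket. [folklore] -/
theorem exists_norm_le_one_add_norm_pow_neg [NormedSpace ℝ V] (ψ : 𝓢(V, ℂ)) (k : ℕ) :
    ∃ C : ℝ, 0 ≤ C ∧ ∀ x : V, ‖ψ x‖ ≤ C * (1 + ‖x‖) ^ (-(k : ℝ)) := by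
  set C : ℝ := 2 ^ k * ((Finset.Iic (k, 0)).sup fun m => SchwartzMap.seminorm ℂ m.1 m.2) ψ
  refine ⟨C, by positivity, fun x => ?_⟩
  have h := SchwartzMap.one_add_le_sup_seminorm_apply (𝕜 := ℂ) (m := (k, 0)) (k := k) (n := 0)
    le_rfl le_rfl ψ x
  rw [norm_iteratedFDeriv_zero] at h
  have hpos : 0 < (1 + ‖x‖) ^ k := by positivity
  rw [Real.rpow_neg (by positivity), Real.rpow_natCast, ← div_eq_mul_inv, le_div_iff₀ hpos]
  calc ‖ψ x‖ * (1 + ‖x‖) ^ k = (1 + ‖x‖) ^ k * ‖ψ x‖ := mul_comm _ _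
    _ ≤ C := h

omit [InnerProductSpace ℝ V] [FiniteDimensional ℝ V] [MeasurableSpace V] [BorelSpace V] in
/-- Translates by vectors of norm `≤ 1` are uniformly dominated:
`(1 + ‖x + e‖)^{−k} ≤ 2^k (1 + ‖x‖)^{−k}`. [folklore] -/
theorem one_add_norm_add_rpow_neg_le {x e : V} (he : ‖e‖ ≤ 1) (k : ℕ) :
    (1 + ‖x + e‖) ^ (-(k : ℝ)) ≤ 2 ^ k * (1 + ‖x‖) ^ (-(k : ℝ)) := by
  have h1 : 1 + ‖x‖ ≤ 2 * (1 + ‖x + e‖) := by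
    have : ‖x‖ ≤ ‖x + e‖ + ‖e‖ := by
      calc ‖x‖ = ‖(x + e) - e‖ := by rw [add_sub_cancel_right]
        _ ≤ ‖x + e‖ + ‖e‖ := norm_sub_le _ _
    linarith [norm_nonneg (x + e)]
  have hA : 0 < (1 + ‖x + e‖) ^ k := by positivity
  have hB : 0 < (1 + ‖x‖) ^ k := by positivity
  have key : (1 + ‖x‖) ^ k ≤ 2 ^ k * (1 + ‖x + e‖) ^ k := by
    rw [← mul_pow]
    exact pow_le_pow_left₀ (by positivity) h1 k
  rw [Real.rpow_neg (by positivity), Real.rpow_neg (by positivity), Real.rpow_natCast,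
    Real.rpow_natCast]
  calc ((1 + ‖x + e‖) ^ k)⁻¹ = ((1 + ‖x‖) ^ k)⁻¹ * ((1 + ‖x‖) ^ k / (1 + ‖x + e‖) ^ k) := by
        field_simp
    _ ≤ ((1 + ‖x‖) ^ k)⁻¹ * 2 ^ k := by
        gcongr
        rw [div_le_iff₀ hA]
        exact key
    _ = 2 ^ k * ((1 + ‖x‖) ^ k)⁻¹ := mul_comm _ _

/-- **Continuity of translation in `L¹`** for a Schwartz function:
`∫ ‖ψ(w + e) − ψ(w)‖ dw → 0` as `e → 0`. [folklore] -/
theorem tendsto_integral_norm_translate_sub (ψ : 𝓢(V, ℂ)) :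
    Tendsto (fun e : V => ∫ w, ‖ψ (w + e) - ψ w‖) (𝓝 0) (𝓝 0) := by
  set k : ℕ := Module.finrank ℝ V + 1 with hk
  obtain ⟨C, hC0, hC⟩ := exists_norm_le_one_add_norm_pow_neg ψ k
  have hint : Integrable fun w : V => (1 + ‖w‖) ^ (-(k : ℝ)) :=
    integrable_one_add_norm (by rw [hk]; push_cast; linarith)
  have hlim : Tendsto (fun e : V => ∫ w, ‖ψ (w + e) - ψ w‖) (𝓝 0)
      (𝓝 (∫ w : V, ‖ψ (w + 0) - ψ w‖)) := by
    refine tendsto_integral_filter_of_dominated_convergence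
      (fun w => (2 ^ k * C + C) * (1 + ‖w‖) ^ (-(k : ℝ))) ?_ ?_ (hint.const_mul _) ?_
    · exact Eventually.of_forall fun e =>
        ((ψ.continuous.comp (continuous_id.add continuous_const)).sub ψ.continuous).norm
          |>.aestronglyMeasurable
    · filter_upwards [Metric.closedBall_mem_nhds (0 : V) one_pos] with e he
      rw [Metric.mem_closedBall, dist_zero_right] at he
      refine Eventually.of_forall fun w => ?_
      rw [Real.norm_eq_abs, abs_of_nonneg (norm_nonneg _)]
      calc ‖ψ (w + e) - ψ w‖ ≤ ‖ψ (w + e)‖ + ‖ψ w‖ := norm_sub_le _ _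
        _ ≤ C * (1 + ‖w + e‖) ^ (-(k : ℝ)) + C * (1 + ‖w‖) ^ (-(k : ℝ)) :=
            add_le_add (hC _) (hC _)
        _ ≤ C * (2 ^ k * (1 + ‖w‖) ^ (-(k : ℝ))) + C * (1 + ‖w‖) ^ (-(k : ℝ)) := by
            gcongr
            exact one_add_norm_add_rpow_neg_le he k
        _ = (2 ^ k * C + C) * (1 + ‖w‖) ^ (-(k : ℝ)) := by ring
    · exact Eventually.of_forall fun w =>
        (((ψ.continuous.comp (continuous_const.add continuous_id)).sub continuous_const).norm).tendsto 0
  simpa using hlim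

/-- Rescaled translates: `∫ ‖Rⁿψ(R(v − c)) − Rⁿψ(R(v − c'))‖ dv = ∫ ‖ψ(w + R(c − c')) − ψ(w)‖ dw`
(`n = dim V`; translate, then scale). [folklore] -/
theorem integral_norm_scaled_translate_sub (ψ : 𝓢(V, ℂ)) {R : ℝ} (hR : 0 < R) (c c' : V) :
    ∫ v, ‖(R ^ Module.finrank ℝ V : ℝ) • ψ (R • (v - c)) -
        (R ^ Module.finrank ℝ V : ℝ) • ψ (R • (v - c'))‖ =
      ∫ w, ‖ψ (w + R • (c - c')) - ψ w‖ := by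
  set n : ℕ := Module.finrank ℝ V with hn
  have h1 : (fun v => ‖(R ^ n : ℝ) • ψ (R • (v - c)) - (R ^ n : ℝ) • ψ (R • (v - c'))‖) =
      fun v => (fun w => (R ^ n : ℝ) * ‖ψ (w - R • c) - ψ (w - R • c')‖) (R • v) := by
    funext v
    rw [← smul_sub, norm_smul, Real.norm_eq_abs, abs_of_pos (pow_pos hR n), smul_sub, smul_sub]
  rw [h1, Measure.integral_comp_smul_of_nonneg volume
      (fun w => (R ^ n : ℝ) * ‖ψ (w - R • c) - ψ (w - R • c')‖) R (hR := hR.le),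
    integral_const_mul, smul_eq_mul, ← mul_assoc, inv_mul_cancel₀ (pow_ne_zero _ hR.ne'), one_mul,
    ← integral_add_right_eq_self (fun w => ‖ψ (w - R • c) - ψ (w - R • c')‖) (R • c)]
  refine integral_congr_ae (Eventually.of_forall fun u => ?_)
  simp only [add_sub_cancel_right]
  rw [norm_sub_rev, smul_sub, add_sub_assoc]

end Literature.Analysis.Distribution
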